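import Summits.ABC.IUTFork.Joshi.ATS4LogDiffConductorIdentity
import Literature.NumberTheory.NumberFields.DedekindDifferentBoundGeneral
import Literature.IUT.LogVolume.FakeAdeleIndex
import Literature.IUT.LogVolume.DistinguishedPrimesBound
import Literature.IUT.LogVolume.DifferentConductorTowerBounds
import Mathlib.NumberTheory.RamificationInertia.Unramified
import HarnessLib

/-!
# Joshi, *Arithmetic Teichmüller Spaces IV* (arXiv:2403.10430v2) Thm. 4.6.1 (5) with the PRINTED constant and Cor. 4.6.15
# — PROVED over Mathlib number fields for EVERY extension `M/L` (no Galois hypothesis)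

Proof-only companion of `Joshi/ATS4LogDiffConductor.lean` (abc-iut cell, branch E, rung LADDER-ABC:A2.E; seat abc-iut-E-t27,
slot T-27). **No side is taken** on [IUTchIII] Cor. 3.12, on Joshi's claims, or on Mochizuki's reports on them; the source is an
unrefereed arXiv preprint; the mathematics discharged here is classical (Dedekind–Hensel). Locators «p.N l.M» refer to the
render `HOME/lit/renders/Joshi-arxiv-2403.10430/` (v2).

The typed claims `LogDiffCond.WildBound L M S S_wild` ([J-IV] Thm. 4.6.1 (5), p.46 l.42–46: «(log d_M + log f_M) − (log d_L +
log f_L) ≤ #S^ℚ_wild · log[M : L]» for `M/L` wildly ramified only above `S_wild`) and `LogDiffCond.Cor4615 L V0 d S S_wild`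
(Cor. 4.6.15, p.49 l.4–18: a constant `c > 0` bounding the difference over the family `[M:L] ≤ d`, unramified outside `S`, tame
outside `S_wild`) were left as HYPOTHESES by `ATS4LogDiffConductor.lean` because they rest on the non-Galois different bound
[Bombieri–Gubler 2006, B.2.12] (Dedekind–Hensel `ord_w 𝔡_{M/L} ≤ e_{w|v} − 1 + ord_w(e_{w|v})`); `ATS4LogDiffConductorWildGalois.lean`
proved the GALOIS case with the weaker constant `#P·log[M:L] + Σ_{p∈P} log p`. The non-Galois bound is now the tree's
`Literature.NumberTheory.NumberFields.multiplicity_differentIdeal_succ_le` (`DedekindDifferentBoundGeneral.lean`, abc-iut-w6-d109).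
With it, and the exact identity `[M:ℚ]·Δ = Σ_w τ_w·log N(w) + Σ_{w ∉ V^{odd,ss}_M} (e_w − 1)·log N(w)` of
`ATS4LogDiffConductorIdentity.lean` (`finrank_mul_delta_eq_tau_add`), this file PROVES:

* `tau_mul_logNorm_le` — `τ_w·log N(w) ≤ [M_w:ℚ_p]·log[M:L]` at every prime `w` of every `M/L` (`τ_w ≤ e(w|p)·v_p(e_w)` and
  `p^{v_p(e_w)} ≤ e_w ≤ [M:L]`), and `sum_tau_mul_logNorm_le` — `Σ_w τ_w·log N(w) ≤ [M:ℚ]·#S^ℚ_wild·log[M:L]` when the wild primes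
  lie over `S_wild` (fundamental identity `Σ_{w|p} e(w|p) f(w|p) = [M:ℚ]`);
* **`wildBound_of_unramifiedOutside` / `wildBound_of_isUnramifiedAt` — Thm. 4.6.1 (5) WITH THE PRINTED CONSTANT `#S^ℚ_wild·log[M:L]`
  holds for EVERY extension `M/L` unramified outside `V^{odd,ss}_M`** (the presupposition flag F-b of the typed file locates in
  the printed derivation; no Galois hypothesis);
* `not_wildBound_of_isTame_of_ramified_outside` — the located correction in kernel form for item (5): as TYPED (hypothesis «wild
  primes lie over S_wild» only), `WildBound L M S ∅` FAILS whenever `M/L` is tamely ramified everywhere and ramified at a prime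
  outside `V^{odd,ss}_M` (e.g. `ℚ(√5)/ℚ`, `S = ∅` — inhabitation of the hypothesis is not proved here);
* `delta_le_sum_log_general` / `wildBound_card_general` — the hypotheses of `wildBound_of_isGalois(_card)` WITHOUT `[IsGalois L M]`:
  `Δ ≤ Σ_{p∈P} (⌊log_p[M:L]⌋ + 1)·log p ≤ #P·log[M:L] + Σ_{p∈P} log p`;
* **`cor4615_holds : Cor4615 L V0 d S S_wild` — [J-IV] Cor. 4.6.15 as typed is a THEOREM for all parameters**, with the explicit
  constant `c = 1 + #S_wild·log d + [L:ℚ]⁻¹·Σ_{v∈S} log N(v)` depending on `(L, d, S, S_wild)` only (flag F-d), for the family as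
  typed (`[M:L] ≤ d`, `M/L` unramified outside `S`, wild primes over `S_wild`; `V0 = V^{odd,ss}_L` arbitrary).

Theorems only; standard axioms; no `sorry`, instance, notation or new `Prop` fact. [claim: Joshi2024ATS4, status: disputed]
(provenance of the typed items; nothing endorsed).
-/

noncomputable section

namespace Summit.ABC.IUTFork.Joshi.ATS4

namespace LogDiffCond

open NumberField IsDedekindDomain Ideal Module Literature.IUT.LogVolume
open Literature.NumberTheory.NumberFields (multiplicity_differentIdeal_succ_le multiplicity_span_natCast
  multiplicity_differentIdeal_lt_absolute)
open scoped Classical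

variable (L M : Type*) [Field L] [NumberField L] [Field M] [NumberField M] [Algebra L M]

/-! ### The wild excess at one prime: `τ_w·log N(w) ≤ [M_w:ℚ_p]·log[M:L]` -/

/-- **Dedekind–Hensel for the typed `τ`**: `τ_w ≤ e(w|p)·v_p(e_{w|v})` at every prime `w` of every extension `M/L`
(`ord_w 𝔡_{M/L} + 1 ≤ e_{w|v} + ord_w((e_{w|v}))`, the tree's `multiplicity_differentIdeal_succ_le`, and
`ord_w((n)) = e(w|p)·v_p(n)`, `multiplicity_span_natCast`; the typed-vocabulary twin `τ_w ≤ e_{w|v}·ord_v(e_{w|v})` is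
`tau_le` of `ATS4LogDiffConductorTauBounds.lean`). [cite: BombieriGubler2006, Thm B.2.12] -/
theorem tau_le_ramificationIdx_int_mul_factorization (w : HeightOneSpectrum (𝓞 M)) :
    tau L M w ≤ w.asIdeal.ramificationIdx ℤ *
      (relRamIdx L M w).factorization (Literature.IUT.LogVolume.residueChar M w) := by
  haveI := w.isMaximal
  have he0 : relRamIdx L M w ≠ 0 := by
    have := one_le_relRamIdx L M w; omega
  have h1 := multiplicity_differentIdeal_succ_le L M w.asIdeal
  rw [← relRamIdx_eq, ← relDiffExp_eq_multiplicity, multiplicity_span_natCast M w.asIdeal he0,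
    relDiffExp_eq_tau_add] at h1
  have h2 := one_le_relRamIdx L M w
  unfold Literature.IUT.LogVolume.residueChar
  omega

/-- `e_{w|v} ≤ [M:L]` (Mathlib `Ideal.ramificationIdx_le_finrank`, from `Σ_{w|v} e_w f_w = [M:L]`). [folklore] -/
theorem relRamIdx_le_finrank (w : HeightOneSpectrum (𝓞 M)) : relRamIdx L M w ≤ finrank L M := by
  haveI := w.isMaximal
  haveI : (w.asIdeal.under (𝓞 L)).IsMaximal := Ideal.IsMaximal.under (𝓞 L) w.asIdeal
  haveI : w.asIdeal.LiesOver (w.asIdeal.under (𝓞 L)) := ⟨rfl⟩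
  haveI : NoZeroSMulDivisors (𝓞 L) (𝓞 M) := ⟨fun h => smul_eq_zero.mp h⟩
  exact Ideal.ramificationIdx_le_finrank (R := 𝓞 L) (S := 𝓞 M) L M w.asIdeal

/-- `v_p(n)·log p ≤ log n` for a prime `p` and `n ≥ 1` (`p^{v_p(n)} ≤ n`). [folklore] -/
theorem factorization_mul_log_le {p n : ℕ} (hp : p.Prime) (hn : n ≠ 0) :
    (n.factorization p : ℝ) * Real.log p ≤ Real.log n := by
  have hpow : (p : ℝ) ^ n.factorization p ≤ n := by exact_mod_cast Nat.ordProj_le p hn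
  rw [← Real.log_pow]
  exact Real.log_le_log (pow_pos (by exact_mod_cast hp.pos) _) hpow

/-- **`τ_w·log N(w) ≤ [M_w:ℚ_p]·log[M:L]`** at every prime `w` of every extension `M/L` of number fields, `[M_w:ℚ_p] = e(w|p)·f(w|p)`
the local degree (`τ_w ≤ e(w|p)·v_p(e_w)`, `log N(w) = f(w|p)·log p`, `v_p(e_w)·log p ≤ log e_w ≤ log[M:L]`). This is the
term-by-term content of (4.6.9)–(4.6.13) (p.48 l.30–62) without the Galois hypothesis. [cite: BombieriGubler2006, Thm B.2.12] -/
theorem tau_mul_logNorm_le (w : HeightOneSpectrum (𝓞 M)) :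
    (tau L M w : ℝ) * logNorm M w ≤ (localDegree M w : ℝ) * Real.log (finrank L M) := by
  set p := Literature.IUT.LogVolume.residueChar M w with hp
  have hpp : p.Prime := residueChar_prime M w
  have he0 : relRamIdx L M w ≠ 0 := by
    have := one_le_relRamIdx L M w; omega
  have hτ : (tau L M w : ℝ) ≤ (w.asIdeal.ramificationIdx ℤ : ℝ) * ((relRamIdx L M w).factorization p : ℝ) := by
    exact_mod_cast tau_le_ramificationIdx_int_mul_factorization L M w
  have hvlog : ((relRamIdx L M w).factorization p : ℝ) * Real.log p ≤ Real.log (finrank L M) :=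
    (factorization_mul_log_le hpp he0).trans (Real.log_le_log (by exact_mod_cast Nat.pos_of_ne_zero he0)
      (by exact_mod_cast relRamIdx_le_finrank L M w))
  have hlogp : 0 ≤ Real.log p := Real.log_natCast_nonneg p
  have hres : (0 : ℝ) ≤ resDeg M w := Nat.cast_nonneg _
  have hram : (0 : ℝ) ≤ w.asIdeal.ramificationIdx ℤ := Nat.cast_nonneg _
  rw [logNorm_eq M w, localDegree, ramIdx_eq M w, Nat.cast_mul, ← hp]
  calc (tau L M w : ℝ) * (resDeg M w * Real.log p)
      ≤ (w.asIdeal.ramificationIdx ℤ : ℝ) * ((relRamIdx L M w).factorization p : ℝ) * (resDeg M w * Real.log p) :=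
        mul_le_mul_of_nonneg_right hτ (mul_nonneg hres hlogp)
    _ = (w.asIdeal.ramificationIdx ℤ : ℝ) * resDeg M w * (((relRamIdx L M w).factorization p : ℝ) * Real.log p) := by
        ring
    _ ≤ (w.asIdeal.ramificationIdx ℤ : ℝ) * resDeg M w * Real.log (finrank L M) :=
        mul_le_mul_of_nonneg_left hvlog (mul_nonneg hram hres)

/-! ### Summing over the wild primes: `Σ_w τ_w·log N(w) ≤ [M:ℚ]·#S^ℚ_wild·log[M:L]` -/

omit [NumberField L] [NumberField M] [Algebra L M] in
/-- The residue characteristic of `v ∈ S_wild` lies in `S^ℚ_wild` as the typed file counts it (`ringChar (𝓞 L ⧸ v)`), and every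
member of that image is a prime. [folklore] -/
theorem prime_of_mem_image_ringChar (Swild : Finset (HeightOneSpectrum (𝓞 L))) {p : ℕ}
    (hp : p ∈ Swild.image fun v => ringChar (𝓞 L ⧸ v.asIdeal)) : p.Prime := by
  obtain ⟨v, -, rfl⟩ := Finset.mem_image.mp hp
  have h := residueChar_eq (M := L) v
  unfold LogDiffCond.residueChar at h
  rw [h]
  exact residueChar_prime L v

omit [NumberField L] [NumberField M] in
/-- At a wild prime `w` over `S_wild`, the residue characteristic of `w` lies in `S^ℚ_wild`. [folklore] -/
theorem residueChar_mem_image_of_under_mem (Swild : Finset (HeightOneSpectrum (𝓞 L))) (w : HeightOneSpectrum (𝓞 M))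
    (hw : w.under (𝓞 L) ∈ Swild) :
    Literature.IUT.LogVolume.residueChar M w ∈ Swild.image fun v => ringChar (𝓞 L ⧸ v.asIdeal) := by
  refine Finset.mem_image.mpr ⟨w.under (𝓞 L), hw, ?_⟩
  have h := residueChar_eq (M := L) (w.under (𝓞 L))
  unfold LogDiffCond.residueChar at h
  rw [h, show w.under (𝓞 L) = finBelow L M w from HeightOneSpectrum.ext rfl, residueChar_finBelow]

/-- **`Σ_{w ∈ D} τ_w·log N(w) ≤ [M:ℚ]·#S^ℚ_wild·log[M:L]`** for any finite set `D` of primes of `M`, when every wildly ramified prime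
of `M/L` lies over `S_wild` ((4.6.9)–(4.6.14) p.48 l.30 – p.49 l.1 without the Galois hypothesis: `τ_w = 0` at tame `w`; at wild
`w` the bound `tau_mul_logNorm_le`; then `Σ_{w|p} [M_w:ℚ_p] = [M:ℚ]` for each `p ∈ S^ℚ_wild`). [cite: BombieriGubler2006, Thm B.2.12] -/
theorem sum_tau_mul_logNorm_le (Swild : Finset (HeightOneSpectrum (𝓞 L)))
    (hwild : ∀ w : HeightOneSpectrum (𝓞 M), ¬ IsTameAt L M w → w.under (𝓞 L) ∈ Swild)
    (D : Finset (HeightOneSpectrum (𝓞 M))) :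
    ∑ w ∈ D, (tau L M w : ℝ) * logNorm M w ≤
      (finrank ℚ M : ℝ) * ((wildRationalCount L Swild : ℝ) * Real.log (finrank L M)) := by
  set P : Finset ℕ := Swild.image fun v => ringChar (𝓞 L ⧸ v.asIdeal) with hPdef
  have hP : ∀ p ∈ P, p.Prime := fun p hp => prime_of_mem_image_ringChar L Swild hp
  have hlog : 0 ≤ Real.log (finrank L M) := Real.log_natCast_nonneg _
  -- pointwise
  have hpt : ∀ w ∈ D, (tau L M w : ℝ) * logNorm M w ≤
      if Literature.IUT.LogVolume.residueChar M w ∈ P then (localDegree M w : ℝ) * Real.log (finrank L M) else 0 := by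
    intro w _
    by_cases htame : IsTameAt L M w
    · rw [tau_eq_zero_of_isTameAt' L M w htame, Nat.cast_zero, zero_mul]
      split_ifs
      · exact mul_nonneg (Nat.cast_nonneg _) hlog
      · exact le_rfl
    · rw [if_pos (residueChar_mem_image_of_under_mem L M Swild w (hwild w htame))]
      exact tau_mul_logNorm_le L M w
  refine (Finset.sum_le_sum hpt).trans ?_
  rw [← Finset.sum_filter]
  -- enlarge the index set to all places over `P`
  have hsub : ∑ w ∈ D.filter (fun w => Literature.IUT.LogVolume.residueChar M w ∈ P),
      (localDegree M w : ℝ) * Real.log (finrank L M) ≤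
      ∑ w ∈ P.biUnion (placesOver M), (localDegree M w : ℝ) * Real.log (finrank L M) := by
    refine Finset.sum_le_sum_of_subset_of_nonneg (fun w hw => ?_) (fun w _ _ => mul_nonneg (Nat.cast_nonneg _) hlog)
    obtain ⟨-, hp⟩ := Finset.mem_filter.mp hw
    exact Finset.mem_biUnion.mpr ⟨_, hp, mem_placesOver_residueChar w⟩
  refine hsub.trans (le_of_eq ?_)
  have hdisj : (↑P : Set ℕ).PairwiseDisjoint (placesOver M) := by
    intro p hp q hq hne
    haveI : Fact p.Prime := ⟨hP p hp⟩
    haveI : Fact q.Prime := ⟨hP q hq⟩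
    exact Finset.disjoint_left.mpr fun w hw hw' =>
      hne (((mem_placesOver_iff_residueChar w).mp hw).symm.trans ((mem_placesOver_iff_residueChar w).mp hw'))
  rw [Finset.sum_biUnion hdisj]
  have hinner : ∀ p ∈ P, ∑ w ∈ placesOver M p, (localDegree M w : ℝ) * Real.log (finrank L M) =
      (finrank ℚ M : ℝ) * Real.log (finrank L M) := by
    intro p hp
    haveI : Fact p.Prime := ⟨hP p hp⟩
    rw [← Finset.sum_mul, ← Nat.cast_sum, sum_localDegree M p]
  rw [Finset.sum_congr rfl hinner, Finset.sum_const, nsmul_eq_mul, wildRationalCount]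
  ring

/-! ### Thm. 4.6.1 (5) with the printed constant, for every `M/L` unramified outside `V^{odd,ss}_M` -/

/-- **[J-IV] Thm. 4.6.1 (5) — PROVED with the PRINTED constant for every extension `M/L` of number fields unramified outside
`V^{odd,ss}_M`** (p.46 l.42–46 «(log d_M + log f_M) − (log d_L + log f_L) ≤ #S^ℚ_wild · log[M : L]»; proof (4.6.9)–(4.6.14)):
if `e_{w|v} = 1` at every prime `w` of `M` outside `V^{odd,ss}_M = ssAbove L M S` (the presupposition flag F-b locates in the
printed step (4.6.5) − (4.6.6)), then the typed `WildBound L M S S_wild` holds: wild primes over `S_wild` ⟹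
`Δ ≤ #S^ℚ_wild·log[M:L]`. No Galois hypothesis (Dedekind–Hensel in general, `multiplicity_differentIdeal_succ_le`).
[cite: BombieriGubler2006, Thm B.2.12] -/
theorem wildBound_of_unramifiedOutside (S Swild : Finset (HeightOneSpectrum (𝓞 L)))
    (hunr : ∀ w : HeightOneSpectrum (𝓞 M), w ∉ ssAbove L M S → relRamIdx L M w = 1) :
    WildBound L M S Swild := by
  intro hwild
  have hM : (0 : ℝ) < finrank ℚ M := by exact_mod_cast finrank_pos
  obtain ⟨D, hTD, hD⟩ := exists_support L M S
  have key := finrank_mul_delta_eq_tau_of_unramified_outside L M S D hTD hD hunr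
  have hsum := sum_tau_mul_logNorm_le L M Swild hwild D
  rw [← key] at hsum
  exact le_of_mul_le_mul_left hsum hM

/-- **The same with the hypothesis in Mathlib's `Algebra.IsUnramifiedAt` spelling** (as in the typed `Cor4615`): if `M/L` is
unramified at every prime outside `V^{odd,ss}_M`, then `WildBound L M S S_wild`. [cite: BombieriGubler2006, Thm B.2.12] -/
theorem wildBound_of_isUnramifiedAt (S Swild : Finset (HeightOneSpectrum (𝓞 L)))
    (hunr : ∀ w : HeightOneSpectrum (𝓞 M), w ∉ ssAbove L M S → Algebra.IsUnramifiedAt (𝓞 L) w.asIdeal) :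
    WildBound L M S Swild := by
  refine wildBound_of_unramifiedOutside L M S Swild fun w hw => ?_
  haveI := w.isPrime
  haveI := hunr w hw
  rw [relRamIdx_eq]
  exact Ideal.ramificationIdx_eq_one_of_isUnramifiedAt

/-- **Located correction for item (5), kernel form**: as TYPED — the only hypothesis being «the wild primes lie over S_wild» —
`WildBound L M S ∅` FAILS for every `M/L` that is tamely ramified at every prime and ramified at some prime `w₀` outside
`V^{odd,ss}_M` (then `#S^ℚ_wild = 0` while `Δ ≥ [M:ℚ]⁻¹·(e_{w₀} − 1)·log N(w₀) > 0`, `delta_pos_of_ramified_outside`); e.g.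
`ℚ(√5)/ℚ` with `S = ∅` (inhabitation not proved here). So (5) as printed carries the presupposition «M/L unramified outside
V^{odd,ss}_L» (flag F-b) exactly like (1)/(3)/(4). Located, not adjudicated. [cite: MochizukiGenEll2010, Prop 1.7 (i) p.9] -/
theorem not_wildBound_of_isTame_of_ramified_outside (S : Finset (HeightOneSpectrum (𝓞 L))) (htame : IsTame L M)
    (w₀ : HeightOneSpectrum (𝓞 M)) (hw₀ : w₀ ∉ ssAbove L M S) (hram : relRamIdx L M w₀ ≠ 1) :
    ¬ WildBound L M S ∅ := by
  intro h
  have h1 := h fun w hw => absurd (htame w) hw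
  have h2 := delta_pos_of_ramified_outside L M S w₀ hw₀ hram
  simp [wildRationalCount] at h1
  linarith

/-! ### The hypotheses of the Galois companion, without the Galois hypothesis -/

/-- `v_p(e_{w|v}) ≤ ⌊log_p [M:L]⌋` (`p^{v_p(e)} ≤ e ≤ [M:L]`). [folklore] -/
theorem factorization_relRamIdx_le_log (w : HeightOneSpectrum (𝓞 M)) {p : ℕ} (hp : p.Prime) :
    (relRamIdx L M w).factorization p ≤ Nat.log p (finrank L M) := by
  have he0 : relRamIdx L M w ≠ 0 := by
    have := one_le_relRamIdx L M w; omega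
  exact (Nat.le_log_of_pow_le hp.one_lt (Nat.ordProj_le p he0)).trans
    (Nat.log_mono_right (relRamIdx_le_finrank L M w))

/-- **`Δ ≤ Σ_{p∈P} (⌊log_p[M:L]⌋ + 1)·log p` for EVERY `M/L`** unramified at the primes outside `V^{odd,ss}_M` resp. tamely ramified
at the primes of `V^{odd,ss}_M`, of residue characteristic `∉ P` — the hypotheses of `wildBound_of_isGalois` with `[IsGalois L M]`
DROPPED (the tree's [IUTchIV] Thm. 1.10 Step (ii) engine `ndeg_different_add_reduced_le` fed with the non-Galois bound
`ord_w 𝔡_{M/L} + 1 ≤ e(w|p)·(v_p(e_w) + 1)`, `multiplicity_differentIdeal_lt_absolute`). [cite: BombieriGubler2006, Thm B.2.12] -/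
theorem delta_le_sum_log_general (S : Finset (HeightOneSpectrum (𝓞 L))) (P : Finset ℕ) (hP : ∀ p ∈ P, p.Prime)
    (hunr : ∀ w : HeightOneSpectrum (𝓞 M), LogDiffCond.residueChar M w ∉ P → w ∉ ssAbove L M S → relRamIdx L M w = 1)
    (htame : ∀ w : HeightOneSpectrum (𝓞 M), LogDiffCond.residueChar M w ∉ P → w ∈ ssAbove L M S → IsTameAt L M w) :
    logDiffCond M (ssAbove L M S) - logDiffCond L S ≤
      ∑ p ∈ P, ((Nat.log p (finrank L M) + 1 : ℕ) : ℝ) * Real.log p := by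
  have key := ndeg_different_add_reduced_le L M S (ssAbove L M S) (fun w => mem_ssAbove_iff_finBelow w) P hP
    (fun p => Nat.log p (finrank L M) + 1)
    (fun w hp hS => by
      rw [← relRamIdx_eq]
      exact hunr w (by rwa [residueChar_eq]) (by rwa [mem_ssAbove_iff_finBelow]))
    (fun w hp hS => by
      have h := htame w (by rwa [residueChar_eq]) (by rwa [mem_ssAbove_iff_finBelow])
      rw [IsTameAt, residueChar_eq, relRamIdx_eq] at h
      exact h)
    (fun w hp => by
      haveI := w.isMaximal
      have h1 := multiplicity_differentIdeal_lt_absolute L M w.asIdeal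
      have h2 : (w.asIdeal.ramificationIdx (𝓞 L)).factorization (Ideal.absNorm (w.asIdeal.under ℤ)) ≤
          Nat.log (Literature.IUT.LogVolume.residueChar M w) (finrank L M) := by
        rw [← relRamIdx_eq]
        exact factorization_relRamIdx_le_log L M w (hP _ hp)
      have h3 := Nat.mul_le_mul_left (w.asIdeal.ramificationIdx ℤ) (Nat.succ_le_succ h2)
      have h4 : multiplicity w.asIdeal (differentIdeal (𝓞 L) (𝓞 M)) + 1 ≤
          (Nat.log (Literature.IUT.LogVolume.residueChar M w) (finrank L M) + 1) * w.asIdeal.ramificationIdx ℤ := by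
        rw [mul_comm]; exact h1.trans h3
      omega)
  rw [logDiffCond_eq_ndeg, logDiffCond_eq_ndeg]
  linarith

/-- **`Δ ≤ #P·log[M:L] + Σ_{p∈P} log p` for EVERY `M/L`** under the hypotheses of `wildBound_of_isGalois_card` WITHOUT `[IsGalois L M]`
(`⌊log_p n⌋·log p ≤ log n`). Supersedes the Galois companion's constant. [cite: BombieriGubler2006, Thm B.2.12] -/
theorem wildBound_card_general (S : Finset (HeightOneSpectrum (𝓞 L))) (P : Finset ℕ) (hP : ∀ p ∈ P, p.Prime)
    (hunr : ∀ w : HeightOneSpectrum (𝓞 M), LogDiffCond.residueChar M w ∉ P → w ∉ ssAbove L M S → relRamIdx L M w = 1)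
    (htame : ∀ w : HeightOneSpectrum (𝓞 M), LogDiffCond.residueChar M w ∉ P → w ∈ ssAbove L M S → IsTameAt L M w) :
    logDiffCond M (ssAbove L M S) - logDiffCond L S ≤
      (P.card : ℝ) * Real.log (finrank L M) + ∑ p ∈ P, Real.log p := by
  have h := delta_le_sum_log_general L M S P hP hunr htame
  have hn : finrank L M ≠ 0 := (Nat.pos_iff_ne_zero.mp finrank_pos)
  have hsum : ∑ p ∈ P, ((Nat.log p (finrank L M) + 1 : ℕ) : ℝ) * Real.log p ≤
      ∑ p ∈ P, (Real.log (finrank L M) + Real.log p) := by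
    refine Finset.sum_le_sum fun p hp => ?_
    have hp1 : (1 : ℝ) ≤ p := by exact_mod_cast (hP p hp).one_lt.le
    have hpow : (p : ℝ) ^ Nat.log p (finrank L M) ≤ finrank L M := by
      exact_mod_cast Nat.pow_log_le_self p hn
    have hlogpow : (Nat.log p (finrank L M) : ℝ) * Real.log p ≤ Real.log (finrank L M) := by
      rw [← Real.log_pow]
      exact Real.log_le_log (pow_pos (by linarith) _) hpow
    push_cast
    linarith
  rw [Finset.sum_add_distrib, Finset.sum_const, nsmul_eq_mul] at hsum
  linarith

/-! ### Cor. 4.6.15 as typed: PROVED for all parameters -/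

/-- **The ramified-outside-`V0` term is bounded over the family**: if `M/L` is unramified at every prime not over `S`, then for any
finite `D`, `Σ_{w ∈ D, w ∉ V^{odd,ss}_M} (e_w − 1)·log N(w) ≤ [M:L]·Σ_{v∈S} log N(v)` (the ramified primes lie over `S`, and
`Σ_{w|v} (e_w − 1)·log N(w) ≤ Σ_{w|v} e_w f_w·log N(v) = [M:L]·log N(v)`). [cite: MochizukiGenEll2010, Prop 1.7 (i) p.9] -/
theorem sum_ramified_outside_le (V0 S : Finset (HeightOneSpectrum (𝓞 L)))
    (hS : ∀ w : HeightOneSpectrum (𝓞 M), w.under (𝓞 L) ∉ S → Algebra.IsUnramifiedAt (𝓞 L) w.asIdeal)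
    (D : Finset (HeightOneSpectrum (𝓞 M))) :
    ∑ w ∈ D with w ∉ ssAbove L M V0, ((relRamIdx L M w : ℝ) - 1) * logNorm M w ≤
      (finrank L M : ℝ) * ∑ v ∈ S, logNorm L v := by
  have he1 : ∀ w : HeightOneSpectrum (𝓞 M), w ∉ ssAbove L M S → relRamIdx L M w = 1 := by
    intro w hw
    haveI := w.isPrime
    haveI := hS w (fun h => hw (mem_ssAbove.mpr h))
    rw [relRamIdx_eq]
    exact Ideal.ramificationIdx_eq_one_of_isUnramifiedAt
  have hnn : ∀ w : HeightOneSpectrum (𝓞 M), 0 ≤ ((relRamIdx L M w : ℝ) - 1) * logNorm M w := fun w =>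
    mul_nonneg (by
      have h1 : (1 : ℝ) ≤ relRamIdx L M w := by exact_mod_cast one_le_relRamIdx L M w
      linarith) (logNorm_pos M w).le
  -- terms outside `ssAbove L M S` vanish
  have hpt : ∀ w ∈ D.filter (fun w => w ∉ ssAbove L M V0), ((relRamIdx L M w : ℝ) - 1) * logNorm M w ≤
      if w ∈ ssAbove L M S then ((relRamIdx L M w : ℝ) - 1) * logNorm M w else 0 := by
    intro w _
    split_ifs with h
    · exact le_rfl
    · rw [he1 w h, Nat.cast_one, sub_self, zero_mul]
  refine (Finset.sum_le_sum hpt).trans ?_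
  rw [← Finset.sum_filter]
  calc ∑ w ∈ (D.filter (fun w => w ∉ ssAbove L M V0)).filter (fun w => w ∈ ssAbove L M S),
        ((relRamIdx L M w : ℝ) - 1) * logNorm M w
      ≤ ∑ w ∈ ssAbove L M S, ((relRamIdx L M w : ℝ) - 1) * logNorm M w :=
        Finset.sum_le_sum_of_subset_of_nonneg (fun w hw => (Finset.mem_filter.mp hw).2) (fun w _ _ => hnn w)
    _ ≤ ∑ w ∈ ssAbove L M S, (relRamIdx L M w : ℝ) * logNorm M w :=
        Finset.sum_le_sum fun w _ => by nlinarith [logNorm_pos M w]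
    _ = (finrank L M : ℝ) * ∑ v ∈ S, logNorm L v := by
        rw [← ADivisor.degF_reduced_eq_sum, finrank_mul_degF_reduced_eq_sum L M S (ssAbove L M S)
          (fun w => mem_ssAbove_iff_finBelow w)]
        refine Finset.sum_congr rfl fun w _ => ?_
        rw [pullbackWeight_inr_eq, relRamIdx_eq]

/-- **[J-IV] Corollary 4.6.15 — PROVED as typed, for all `(L, V0, d, S, S_wild)`** (p.49 l.4–18; proof l.23–30): with
`c := 1 + #S_wild·log d + [L:ℚ]⁻¹·Σ_{v∈S} log N(v) > 0` (depending on `L, d, S, S_wild` only — flag F-d), every finite extension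
`M/L` with `[M:L] ≤ d`, unramified outside `S` and wildly ramified only above `S_wild` satisfies
`0 ≤ (log d_M + log f_M) − (log d_L + log f_L) ≤ c` (`f` supported on any `V0 = V^{odd,ss}_L`). Ingredients: the exact identity
`finrank_mul_delta_eq_tau_add`, the wild sum `sum_tau_mul_logNorm_le` (`≤ [M:ℚ]·#S_wild·log d`) and the ramified-outside-`V0` sum
`sum_ramified_outside_le` (`≤ [M:L]·Σ_{v∈S} log N(v)`); lower bound = Thm. 4.6.1 (2). No Galois hypothesis; the printed route
(finitely many local extensions of bounded degree) is replaced by Dedekind–Hensel. [cite: BombieriGubler2006, Thm B.2.12] -/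
theorem cor4615_holds (V0 : Finset (HeightOneSpectrum (𝓞 L))) (d : ℕ) (S Swild : Finset (HeightOneSpectrum (𝓞 L))) :
    Cor4615 L V0 d S Swild := by
  have hL : (0 : ℝ) < finrank ℚ L := by exact_mod_cast finrank_pos
  have hB : 0 ≤ ∑ v ∈ S, logNorm L v := Finset.sum_nonneg fun v _ => (logNorm_pos L v).le
  have hA : 0 ≤ (Swild.card : ℝ) * Real.log d := mul_nonneg (Nat.cast_nonneg _) (Real.log_natCast_nonneg d)
  refine ⟨1 + (Swild.card : ℝ) * Real.log d + (finrank ℚ L : ℝ)⁻¹ * ∑ v ∈ S, logNorm L v,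
    by positivity, fun M _ _ _ hd hS hW => ⟨cor4615_lower L M V0, ?_⟩⟩
  have hM : (0 : ℝ) < finrank ℚ M := by exact_mod_cast finrank_pos
  have hML : (0 : ℝ) < finrank L M := by exact_mod_cast finrank_pos
  obtain ⟨D, hTD, hD⟩ := exists_support L M V0
  have key := finrank_mul_delta_eq_tau_add L M V0 D hTD hD
  -- the wild sum
  have h1 := sum_tau_mul_logNorm_le L M Swild hW D
  have h1' : (wildRationalCount L Swild : ℝ) * Real.log (finrank L M) ≤ (Swild.card : ℝ) * Real.log d := by
    refine mul_le_mul ?_ ?_ (Real.log_natCast_nonneg _) (Nat.cast_nonneg _)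
    · exact_mod_cast Finset.card_image_le
    · exact Real.log_le_log hML (by exact_mod_cast hd)
  have h1'' : ∑ w ∈ D, (tau L M w : ℝ) * logNorm M w ≤ (finrank ℚ M : ℝ) * ((Swild.card : ℝ) * Real.log d) :=
    h1.trans (mul_le_mul_of_nonneg_left h1' hM.le)
  -- the ramified-outside-`V0` sum
  have h2 := sum_ramified_outside_le L M V0 S hS D
  -- assemble: `[M:ℚ]·Δ ≤ [M:ℚ]·A + [M:L]·B` with `[M:ℚ] = [M:L]·[L:ℚ]`
  set Δ := logDiffCond M (ssAbove L M V0) - logDiffCond L V0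
  set A := (Swild.card : ℝ) * Real.log d
  set B := ∑ v ∈ S, logNorm L v
  have hΔ : (finrank ℚ M : ℝ) * Δ ≤ (finrank ℚ M : ℝ) * A + (finrank L M : ℝ) * B := by rw [key]; linarith
  rw [finrank_rat_eq_mul (F := L) (K := M)] at hΔ
  have hml : (0 : ℝ) < finrank L M * finrank ℚ L := mul_pos hML hL
  have hgoal : Δ ≤ A + (finrank ℚ L : ℝ)⁻¹ * B := by
    rw [← sub_nonneg]
    have : A + (finrank ℚ L : ℝ)⁻¹ * B - Δ =
        ((finrank L M : ℝ) * finrank ℚ L * A + finrank L M * B - finrank L M * finrank ℚ L * Δ) /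
          (finrank L M * finrank ℚ L) := by
      field_simp
    rw [this]
    exact div_nonneg (by linarith) hml.le
  linarith

end LogDiffCond

end Summit.ABC.IUTFork.Joshi.ATS4

end
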